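import Summits.QuantumFields.BalabanUV.Beta.FP.AliasDecimateIntegrable
import Summits.QuantumFields.BalabanUV.Beta.GAN24.PushSumSymbol
import Literature.MathematicalPhysics.QuantumFieldTheory.Balaban1983to89.B4Green242Bridge

/-!
# `BalabanUV.Beta.FP.CoarseCovarianceAlias` — road «FP» (binder row D1), row H′2-IR ∕ IR-2 leaf (i) «COARSE COVARIANCE SYMBOL», file 2∕3:
# the double straight-contour sum `C_n = Q_n K Q_nᵀ` of a translation-invariant fine bond kernel `K = latticeKernel Ĝ` is the COARSE lattice
# kernel of the ALIAS-SUM SYMBOL `Ĉ_n(P)_{κλ} = n^{−(d+1)} Σ_{l ∈ {0,…,n−1}^{d+1}} q̂_κ(k_l) · q̂_λ(−k_l) · Ĝ_{κλ}(k_l)`, `k_l = (P + 2πl)∕n`,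
# `q̂_κ = PushSumSymbol.cweight n κ` (the straight-contour weight, a product of Dirichlet-kernel factors); real form `q̂ Ĝ q̂†`

NOT IN PRINT; OUR BOOKKEEPING ([folklore] Fourier analysis on `ℤ^{d+1}`), for the road-FP OWNER's ROW REFINEMENT «IR-2 (i)–(iii) SWARM-READY NOW» (journal
l.21049; design memo `HOME/b2b-balaban-beta-d1-p3/H2IR-DESIGN.md` §IR-2 (i)): the coarse covariance `C_n := Q_n P^{BF} Q_nᵀ` of the re-gauged one shot
(N7-PROOF.v3.1 §2: `Γ₀ = P^{BF} − P^{BF}Q_nᵀ(Q_nP^{BF}Q_nᵀ)⁻¹Q_nP^{BF}`) is coarse-translation-invariant with an explicit `(d+1)×(d+1)` matrix alias-sum symbol —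
the input of (ii) (strip split `n⁻²[|k̂|⁻²Θ_n + F_n]`), (iii) (n-uniform ellipticity: every alias term is `q̂ Ĝ q̂†` with `Ĝ` PSD) and (iv)–(v)
(`latticeKernel_inv_decay` ⟹ `|G_C(u,v)| ≤ C n² e^{−δ|u−v|}`).  `Q_n` is the UNIT-BACKGROUND straight-contour sum `AffineAveraging.contourSum n`, UNNORMALISED
(Bałaban's (1.11) is `n^{−(d+1)}`× it; the owner picks the normalisation — §4 records the scaling: `Q ↦ c·Q` multiplies `Ĉ_n` by `c²`; with the
coarse-unit MEAN `c = n^{−(d+2)}` — THE SYMBOL OF RECORD by the owner's ruling R-FP-21 (C), §5 — the `l = 0` term is `≈ n^{−2}|k|^{−2}(…)` at `d+1 = 4`, the design memo's `n^{−2}`).  The analytic input is leaf-17's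
«ALIAS-DECIMATE*» engine (`GAN24/AliasDecimate.latticeKernel_sum_decimate`, continuous symbols) and its `L¹` twin (file 1∕3 `FP/AliasDecimateIntegrable`,
symbols merely integrable on the zone — the massless BF propagator); the combinatorial input is leaf-17's contour weight `PushSumSymbol.sum_cphase_contour`.

## What is proved ([folklore]∕[our object], `0 sorry`, generic `d`, `n ≥ 1`)
* §1 OBJECTS: `coarseCov n K κ λ u v := Σ_{b,s} Σ_{b′,s′} K κ λ ((n•u + b + s•e_κ) − (n•v + b′ + s′•e_λ))` [our object] with `coarseCov_eq_contourSum`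
  (`= contourSum n (κ x ↦ contourSum n (λ y ↦ K κ λ (x − y)) λ v) κ u`), `coarseCov_add_right` (coarse translation invariance for ANY `K`), `coarseCov_eq_sub_zero`,
  `coarseCov_const_mul`; `covSym n κ λ G P := (n^{d+1})⁻¹ · Σ_l cweight n κ (k_l P) · cweight n λ (−k_l P) · G (k_l P)` [our object].
* §2 THE SYMBOL OF THE DOUBLE CONTOUR SUM: `cphase_sub`, `sum_cphase_contour_zero` (`Σ_a e^{i k·r_a} = cweight n κ k`), **`sum_aliasSym_contour_contour`**
  (`Σ_{a,a′} aliasSym n (r_a − r_{a′}) G = covSym n κ λ G`), `covSym_periodic` (again globally `2π`-periodic: blockings iterate ∕ the coarse zone is a torus).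
* §3 THE IDENTITY: **`coarseCov_latticeKernel`** — for `G` globally `2π`-periodic in each coordinate with `G ∘ ofRealVec` integrable on `[−π,π]^{d+1}` and
  `K κ λ = latticeKernel G`: `coarseCov n K κ λ u v = latticeKernel (covSym n κ λ G) (u − v)`; `coarseCov_latticeKernel_of_continuous` (the same under
  leaf-17's continuity hypothesis, via the tree engine directly); `integrableOn_integrand_covSym`.
* §4 REAL FORM AND NORMALISATION: `gsum_neg_ofReal` (`gsum (−t) n = conj (gsum t n)`, real `t`), `cweight_neg_ofRealVec`, **`covSym_ofRealVec`**
  (`Ĉ_n(k)_{κλ} = n^{−(d+1)} Σ_l q̂_κ(k,l)·Ĝ(k_l)·conj q̂_λ(k,l)`, `q̂_κ(k,l) = cweight n κ (k_l)` — the owner's `q̂ Ĝ q̂†` with DIAGONAL `q̂`), `gsum_zero`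
  (`= n`), `cweight_zero` (`= n^{d+2}`: the `l = 0`, `k = 0` weight), `norm_gsum_ofReal_le` (`≤ n`), `norm_cweight_ofRealVec_le` (`≤ n^{d+2}`),
  `covSym_const_mul`, **`coarseCov_latticeKernel_scaled`** (`Q ↦ c·Q`: `c²·C_n = latticeKernel (c²·Ĉ_n)`).
* §5 THE SYMBOL OF RECORD (owner ruling R-FP-21 (C) + erratum E-FP-5-3, journal l.21280: the MASS-ONE ∕ coarse-unit-mean normalisation `c = n^{−(d+2)}`):
  `coarseCovMean`, **`covSymMean`** [our objects] (`Ĉ_n^{mean} = n^{−(3(d+1)+2)} Σ_l q̂ Ĝ q̂†`, `covSymMean_apply`), **`coarseCovMean_latticeKernel`**, `covSymMean_periodic`.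
WHAT IS NOT HERE: the BF instance `Ĝ = PinfSym ∘ d1Sym` (file 3∕3 `FP/CoarseCovarianceAliasBF`: a periodic complex-momentum extension + gan24-leaf-05-g34's
`PerfectPropagatorBound.integrableOn_PinfSym_d1Sym`); (ii)–(v) of the row; any estimate.
HONEST FRAMING: a symbol identity for the cell's own `U = 1` objects; 0 estimates of Bałaban's objects; 0∕4 row-D1 binders; NOT D1, NOT BetaPertH, NOT the
continuum limit, NOT Clay.  HONEST DEPENDENCY (verbatim): «continuum YM on T⁴ ⇐ BetaPertH ∧ nine spine estimates (0/9 proved); BetaPertH ⇐ (D1) ∧ (D4) ∧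
CAP+tail; G-an2-4 gates asym, D1 and NE2/3/4.»  ABSOLUTE RULE respected: no cited fact, no `def … : Prop`, nothing of the manuscripts asserted.
NAMING: the owner's row name for this object is `CoarseCovarianceSymbol` (R-FP-21 (C)); that module name was taken one minute earlier by leaf-06-g7's
IR-4b part A (the SCALAR coarse INVERSE symbol `Δ^ξ∕F`, commit 20:52Z), so this module is `CoarseCovarianceAlias` (namespace likewise); no content overlaps.
Provenance: D1 formalisation swarm leaf prover 02, gen 7 (prover-b2b-balaban-beta-d1-formalise-leaf-02-g7-0), road-FP row IR-2 (i) (CLAIM journal l.21091,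
statement-first l.21207), 2026-08-20.
-/

noncomputable section

open Complex Set MeasureTheory Finset
open scoped Real BigOperators ComplexConjugate
open Literature.MathematicalPhysics.QuantumFieldTheory.Balaban1983to89
open Literature.MathematicalPhysics.QuantumFieldTheory.Balaban1983to89.Beta
open B4Strip (ofRealVec)
open B4ContourShift (BZ phase integrand fourierBox latticeKernel)
open Beta.FibreInverseDecay (cphase)
open AffineAveraging (Site contourSum box toSite unitVec)
open Summit.QuantumFields.BalabanUV.Beta.GAN24.FibreSymbols (gsum)
open Summit.QuantumFields.BalabanUV.Beta.GAN24.AliasTiling (apt)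
open Summit.QuantumFields.BalabanUV.Beta.GAN24.AliasDecimate (aliasPt aliasSym aliasPt_ofRealVec aliasSym_periodic latticeKernel_sum_decimate
  integrableOn_integrand_aliasSym)
open Summit.QuantumFields.BalabanUV.Beta.GAN24.PushSumSymbol (cweight sum_cphase_contour)
open Summit.QuantumFields.BalabanUV.Beta.FP.AliasDecimateIntegrable (latticeKernel_sum_decimate_of_integrable integrableOn_integrand_aliasSym_of_integrable
  measurableSet_BZ)

namespace Summit.QuantumFields.BalabanUV.Beta.FP.CoarseCovarianceAlias

variable {d : ℕ}

/-! ## §1 The objects: the double straight-contour sum of a fine bond kernel, and its alias-sum symbol -/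

/-- [our object] **THE COARSE COVARIANCE** (double straight-contour sum) of a translation-invariant fine bond kernel `K κ λ (x − y)` at blocking `n`:
`coarseCov n K κ λ u v = Σ_{b ∈ box} Σ_{s<n} Σ_{b′ ∈ box} Σ_{s′<n} K κ λ ((n•u + b + s•e_κ) − (n•v + b′ + s′•e_λ))` — the `(κ,u;λ,v)` entry of `Q_n K Q_nᵀ` for the
UNNORMALISED unit-background straight-contour sum `Q_n = AffineAveraging.contourSum n`. -/
def coarseCov (n : ℕ) (K : Fin (d + 1) → Fin (d + 1) → Site (d + 1) → ℂ) (κ l : Fin (d + 1)) (u v : Site (d + 1)) : ℂ :=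
  ∑ b ∈ box (d + 1) n, ∑ s ∈ Finset.range n, ∑ b' ∈ box (d + 1) n, ∑ s' ∈ Finset.range n,
    K κ l (((n : ℤ) • u + toSite b + (s : ℤ) • unitVec κ) - ((n : ℤ) • v + toSite b' + (s' : ℤ) • unitVec l))

/-- [folklore] DICTIONARY: `coarseCov` IS the iterated `contourSum` — `(Q_n K Q_nᵀ)(κ,u;λ,v) = contourSum n (κ x ↦ contourSum n (λ y ↦ K κ λ (x − y)) λ v) κ u`. -/
theorem coarseCov_eq_contourSum (n : ℕ) (K : Fin (d + 1) → Fin (d + 1) → Site (d + 1) → ℂ) (κ l : Fin (d + 1)) (u v : Site (d + 1)) :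
    coarseCov n K κ l u v = contourSum n (fun κ' x => contourSum n (fun l' y => K κ' l' (x - y)) l v) κ u := by
  simp only [coarseCov, contourSum]

/-- [folklore] COARSE TRANSLATION INVARIANCE (any `K`): `coarseCov n K κ λ (u + w) (v + w) = coarseCov n K κ λ u v`. -/
theorem coarseCov_add_right (n : ℕ) (K : Fin (d + 1) → Fin (d + 1) → Site (d + 1) → ℂ) (κ l : Fin (d + 1)) (u v w : Site (d + 1)) :
    coarseCov n K κ l (u + w) (v + w) = coarseCov n K κ l u v := by
  unfold coarseCov
  refine Finset.sum_congr rfl fun b _ => Finset.sum_congr rfl fun s _ => Finset.sum_congr rfl fun b' _ => Finset.sum_congr rfl fun s' _ => ?_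
  congr 1
  rw [smul_add, smul_add]
  abel

/-- [folklore] Hence `coarseCov n K κ λ u v = coarseCov n K κ λ (u − v) 0`. -/
theorem coarseCov_eq_sub_zero (n : ℕ) (K : Fin (d + 1) → Fin (d + 1) → Site (d + 1) → ℂ) (κ l : Fin (d + 1)) (u v : Site (d + 1)) :
    coarseCov n K κ l u v = coarseCov n K κ l (u - v) 0 := by
  rw [← coarseCov_add_right n K κ l (u - v) 0 v, sub_add_cancel, zero_add]

/-- [folklore] Linearity in the kernel: `coarseCov n (c·K) = c·coarseCov n K`. -/
theorem coarseCov_const_mul (n : ℕ) (c : ℂ) (K : Fin (d + 1) → Fin (d + 1) → Site (d + 1) → ℂ) (κ l : Fin (d + 1)) (u v : Site (d + 1)) :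
    coarseCov n (fun κ' l' x => c * K κ' l' x) κ l u v = c * coarseCov n K κ l u v := by
  simp only [coarseCov, Finset.mul_sum]

/-- [our object] **THE COARSE COVARIANCE SYMBOL** of the fine symbol `G` for the bond directions `(κ, λ)` at blocking `n`, over the COARSE momentum `P`:
`covSym n κ λ G P = (n^{d+1})⁻¹ · Σ_{l ∈ {0,…,n−1}^{d+1}} cweight n κ (k_l P) · cweight n λ (−k_l P) · G (k_l P)`, `k_l P = (P + 2πl)/n` (`AliasDecimate.aliasPt`),
`cweight n κ k = (Π_i gsum (k_i) n)·gsum (k_κ) n` (leaf-17's contour weight). -/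
def covSym (n : ℕ) (κ l : Fin (d + 1)) (G : (Fin (d + 1) → ℂ) → ℂ) : (Fin (d + 1) → ℂ) → ℂ :=
  fun P => ((n : ℂ) ^ (d + 1))⁻¹ * ∑ a : Fin (d + 1) → Fin n, cweight n κ (aliasPt n a P) * cweight n l (-(aliasPt n a P)) * G (aliasPt n a P)

/-- [folklore] Linearity of the symbol: `covSym n κ λ (c·G) = c·covSym n κ λ G`. -/
theorem covSym_const_mul (n : ℕ) (κ l : Fin (d + 1)) (c : ℂ) (G : (Fin (d + 1) → ℂ) → ℂ) :
    covSym n κ l (fun P => c * G P) = fun P => c * covSym n κ l G P := by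
  funext P
  simp only [covSym, Finset.mul_sum]
  refine Finset.sum_congr rfl fun a _ => ?_
  ring

/-! ## §2 The symbol of the double contour sum -/

/-- [folklore] The character of a difference: `e^{i p·(x − y)} = e^{i p·x} · e^{i (−p)·y}`. -/
theorem cphase_sub (x y : Site (d + 1)) (p : Fin (d + 1) → ℂ) : cphase (x - y) p = cphase x p * cphase y (-p) := by
  unfold cphase
  rw [← Complex.exp_add, ← mul_add, ← Finset.sum_add_distrib]
  congr 2
  refine Finset.sum_congr rfl fun μ _ => ?_
  simp only [Pi.sub_apply, Pi.neg_apply, Int.cast_sub]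
  ring

/-- [folklore] The straight-contour sum of the character at offset `0` IS the contour weight: `Σ_{b ∈ box} Σ_{s<n} e^{i k·(b + s e_μ)} = cweight n μ k`. -/
theorem sum_cphase_contour_zero (n : ℕ) (k : Fin (d + 1) → ℂ) (μ : Fin (d + 1)) :
    ∑ b ∈ box (d + 1) n, ∑ s ∈ Finset.range n, cphase (toSite b + (s : ℤ) • unitVec μ) k = cweight n μ k := by
  have h := sum_cphase_contour n k μ 0
  simp only [add_zero] at h
  rw [h]
  have h0 : cphase (0 : Site (d + 1)) k = 1 := by simp [cphase]
  rw [h0, one_mul]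

/-- [folklore] **THE SYMBOL OF THE DOUBLE CONTOUR SUM**: summing leaf-17's aliased symbols over the two contours gives the coarse covariance symbol —
`Σ_{(b,s)} Σ_{(b′,s′)} aliasSym n ((b + s e_κ) − (b′ + s′ e_λ)) G P = covSym n κ λ G P`
(swap the alias sum outside; `e^{i k_l·(r_a − r_{a′})} = e^{i k_l·r_a}·e^{−i k_l·r_{a′}}`; the two contour sums are `cweight n κ (k_l)` and `cweight n λ (−k_l)`). -/
theorem sum_aliasSym_contour_contour (n : ℕ) (κ l : Fin (d + 1)) (G : (Fin (d + 1) → ℂ) → ℂ) (P : Fin (d + 1) → ℂ) :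
    ∑ a ∈ (box (d + 1) n ×ˢ Finset.range n) ×ˢ (box (d + 1) n ×ˢ Finset.range n),
      aliasSym n ((toSite a.1.1 + (a.1.2 : ℤ) • unitVec κ) - (toSite a.2.1 + (a.2.2 : ℤ) • unitVec l)) G P = covSym n κ l G P := by
  unfold aliasSym covSym
  rw [← Finset.mul_sum]
  congr 1
  rw [Finset.sum_comm]
  refine Finset.sum_congr rfl fun c _ => ?_
  -- at the alias momentum `k := aliasPt n c P`
  set k : Fin (d + 1) → ℂ := aliasPt n c P with hk
  simp_rw [cphase_sub _ _ k]
  rw [← Finset.sum_mul]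
  congr 1
  rw [Finset.sum_product, Finset.sum_product]
  have h1 : ∀ b ∈ box (d + 1) n, ∀ s ∈ Finset.range n,
      ∑ a' ∈ box (d + 1) n ×ˢ Finset.range n, cphase (toSite b + (s : ℤ) • unitVec κ) k * cphase (toSite a'.1 + (a'.2 : ℤ) • unitVec l) (-k)
        = cphase (toSite b + (s : ℤ) • unitVec κ) k * cweight n l (-k) := by
    intro b _ s _
    rw [← Finset.mul_sum, Finset.sum_product, sum_cphase_contour_zero]
  rw [Finset.sum_congr rfl fun b hb => Finset.sum_congr rfl fun s hs => h1 b hb s hs]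
  simp_rw [← Finset.sum_mul]
  rw [sum_cphase_contour_zero]

/-- [folklore] **THE COARSE COVARIANCE SYMBOL IS AGAIN GLOBALLY `2π`-PERIODIC** in each coarse coordinate when `G` is (blockings iterate; the coarse zone
is a torus — the input of a strip-analyticity statement for (ii)). -/
theorem covSym_periodic (n : ℕ) [NeZero n] (κ l : Fin (d + 1)) {G : (Fin (d + 1) → ℂ) → ℂ}
    (hper : ∀ (i : Fin (d + 1)) (P : Fin (d + 1) → ℂ), G (Function.update P i (P i + 2 * π)) = G P)
    (i : Fin (d + 1)) (P : Fin (d + 1) → ℂ) :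
    covSym n κ l G (Function.update P i (P i + 2 * π)) = covSym n κ l G P := by
  rw [← sum_aliasSym_contour_contour, ← sum_aliasSym_contour_contour]
  exact Finset.sum_congr rfl fun a _ => aliasSym_periodic n hper _ i P

/-! ## §3 The identity: the double contour sum of a lattice kernel is the coarse lattice kernel of `covSym` -/

/-- [folklore] The offsets of the two contours subtract inside one coarse block:
`(n•u + r) − (n•v + r′) = n•(u − v) + (r − r′)`. -/
theorem contour_offset_sub (n : ℕ) (u v r r' : Site (d + 1)) :
    ((n : ℤ) • u + r) - ((n : ℤ) • v + r') = (n : ℤ) • (u - v) + (r - r') := by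
  rw [smul_sub]; abel

/-- [folklore] `coarseCov` of `latticeKernel G` as ONE weighted offset sum over the product of the two contours (weights `1`). -/
theorem coarseCov_eq_sum_latticeKernel (n : ℕ) {K : Fin (d + 1) → Fin (d + 1) → Site (d + 1) → ℂ} {G : (Fin (d + 1) → ℂ) → ℂ} {κ l : Fin (d + 1)}
    (hK : ∀ x, K κ l x = latticeKernel G x) (u v : Site (d + 1)) :
    coarseCov n K κ l u v = ∑ a ∈ (box (d + 1) n ×ˢ Finset.range n) ×ˢ (box (d + 1) n ×ˢ Finset.range n),
      (1 : ℂ) * latticeKernel G ((n : ℤ) • (u - v) + ((toSite a.1.1 + (a.1.2 : ℤ) • unitVec κ) - (toSite a.2.1 + (a.2.2 : ℤ) • unitVec l))) := by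
  unfold coarseCov
  rw [Finset.sum_product, Finset.sum_product]
  refine Finset.sum_congr rfl fun b _ => Finset.sum_congr rfl fun s _ => ?_
  rw [Finset.sum_product]
  refine Finset.sum_congr rfl fun b' _ => Finset.sum_congr rfl fun s' _ => ?_
  rw [one_mul, hK, ← contour_offset_sub, add_assoc, add_assoc]

/-- [our object] **THE COARSE COVARIANCE IS THE COARSE LATTICE KERNEL OF ITS ALIAS-SUM SYMBOL** (`L¹` form — the one the massless BF propagator needs):
for `G` globally `2π`-periodic in each coordinate with `G ∘ ofRealVec` integrable on `[−π,π]^{d+1}`, and `K κ λ = latticeKernel G`,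
`coarseCov n K κ λ u v = latticeKernel (covSym n κ λ G) (u − v)`.  In particular `C_n` is coarse-translation-invariant with symbol `Ĉ_n = covSym`. -/
theorem coarseCov_latticeKernel (n : ℕ) [NeZero n] {K : Fin (d + 1) → Fin (d + 1) → Site (d + 1) → ℂ} {G : (Fin (d + 1) → ℂ) → ℂ} {κ l : Fin (d + 1)}
    (hK : ∀ x, K κ l x = latticeKernel G x)
    (hper : ∀ (i : Fin (d + 1)) (P : Fin (d + 1) → ℂ), G (Function.update P i (P i + 2 * π)) = G P)
    (hG : IntegrableOn (fun p => G (ofRealVec p)) (BZ (d + 1))) (u v : Site (d + 1)) :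
    coarseCov n K κ l u v = latticeKernel (covSym n κ l G) (u - v) := by
  rw [coarseCov_eq_sum_latticeKernel n hK, latticeKernel_sum_decimate_of_integrable n _ (fun _ => (1 : ℂ)) _ hper hG (u - v)]
  congr 1
  funext P
  simp only [one_mul]
  exact sum_aliasSym_contour_contour n κ l G P

/-- [our object] The same under leaf-17's hypothesis «`G ∘ ofRealVec` CONTINUOUS» (massive ∕ regular symbols), through the tree engine
`AliasDecimate.latticeKernel_sum_decimate` directly. -/
theorem coarseCov_latticeKernel_of_continuous (n : ℕ) [NeZero n] {K : Fin (d + 1) → Fin (d + 1) → Site (d + 1) → ℂ}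
    {G : (Fin (d + 1) → ℂ) → ℂ} {κ l : Fin (d + 1)} (hK : ∀ x, K κ l x = latticeKernel G x)
    (hper : ∀ (i : Fin (d + 1)) (P : Fin (d + 1) → ℂ), G (Function.update P i (P i + 2 * π)) = G P)
    (hcont : Continuous fun p : Fin (d + 1) → ℝ => G (ofRealVec p)) (u v : Site (d + 1)) :
    coarseCov n K κ l u v = latticeKernel (covSym n κ l G) (u - v) := by
  rw [coarseCov_eq_sum_latticeKernel n hK, latticeKernel_sum_decimate n _ (fun _ => (1 : ℂ)) _ hper hcont (u - v)]
  congr 1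
  funext P
  simp only [one_mul]
  exact sum_aliasSym_contour_contour n κ l G P

/-- [folklore] The integrand of the coarse covariance symbol is integrable on the (coarse) zone. -/
theorem integrableOn_integrand_covSym (n : ℕ) [NeZero n] (κ l : Fin (d + 1)) {G : (Fin (d + 1) → ℂ) → ℂ}
    (hper : ∀ (i : Fin (d + 1)) (P : Fin (d + 1) → ℂ), G (Function.update P i (P i + 2 * π)) = G P)
    (hG : IntegrableOn (fun p => G (ofRealVec p)) (BZ (d + 1))) (z : Site (d + 1)) :
    IntegrableOn (integrand (covSym n κ l G) z) (BZ (d + 1)) := by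
  have h := integrable_finsetSum (μ := volume.restrict (BZ (d + 1)))
    ((box (d + 1) n ×ˢ Finset.range n) ×ˢ (box (d + 1) n ×ˢ Finset.range n))
    (fun a _ => integrableOn_integrand_aliasSym_of_integrable n hper hG
      ((toSite a.1.1 + (a.1.2 : ℤ) • unitVec κ) - (toSite a.2.1 + (a.2.2 : ℤ) • unitVec l)) z)
  refine h.congr (Filter.Eventually.of_forall fun p => ?_)
  unfold integrand
  rw [← sum_aliasSym_contour_contour, Finset.sum_mul]

/-! ## §4 Real form (`q̂ Ĝ q̂†`) and normalisation -/

/-- [folklore] On a real argument the reversed geometric sum is the conjugate: `gsum (−t) n = conj (gsum t n)`. -/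
theorem gsum_neg_ofReal (t : ℝ) (n : ℕ) : gsum (-(t : ℂ)) n = conj (gsum (t : ℂ) n) := by
  unfold gsum
  rw [map_sum]
  refine Finset.sum_congr rfl fun s _ => ?_
  rw [← Complex.exp_conj, map_mul, map_mul, Complex.conj_I, Complex.conj_ofReal, Complex.conj_natCast]
  congr 1
  ring

/-- [folklore] Hence the contour weight at `−k` is the conjugate of the weight at `k` for REAL `k`: `cweight n λ (−k) = conj (cweight n λ k)`. -/
theorem cweight_neg_ofRealVec (n : ℕ) (l : Fin (d + 1)) (q : Fin (d + 1) → ℝ) :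
    cweight n l (-(ofRealVec q)) = conj (cweight n l (ofRealVec q)) := by
  unfold cweight
  rw [map_mul, map_prod]
  have h : ∀ i, gsum ((-(ofRealVec q)) i) n = conj (gsum (ofRealVec q i) n) := by
    intro i
    simp only [Pi.neg_apply, ofRealVec]
    exact gsum_neg_ofReal (q i) n
  simp only [h]

/-- [our object] **REAL FORM OF THE SYMBOL** (the owner's `Ĉ_n(k) = Σ_l q̂(k,l)·Ĝ(k_l)·q̂(k,l)†` with the DIAGONAL `q̂(k,l) = n^{−(d+1)/2} diag_κ cweight n κ (k_l)`):
at a real coarse momentum `p`,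
`covSym n κ λ G (ofRealVec p) = (n^{d+1})⁻¹ Σ_l cweight n κ (k_l) · G (k_l) · conj (cweight n λ (k_l))`, `k_l = ofRealVec ((p + 2πl)/n)`. -/
theorem covSym_ofRealVec (n : ℕ) (κ l : Fin (d + 1)) (G : (Fin (d + 1) → ℂ) → ℂ) (p : Fin (d + 1) → ℝ) :
    covSym n κ l G (ofRealVec p) = ((n : ℂ) ^ (d + 1))⁻¹ *
      ∑ a : Fin (d + 1) → Fin n, cweight n κ (ofRealVec (apt n a p)) * G (ofRealVec (apt n a p)) * conj (cweight n l (ofRealVec (apt n a p))) := by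
  unfold covSym
  congr 1
  refine Finset.sum_congr rfl fun a _ => ?_
  rw [aliasPt_ofRealVec, cweight_neg_ofRealVec]
  ring

/-- [folklore] `gsum 0 n = n`. -/
theorem gsum_zero (n : ℕ) : gsum 0 n = n := by
  simp [gsum]

/-- [folklore] THE NORMALISATION CHECK: the contour weight at zero momentum is the number of bond readings, `cweight n κ 0 = n^{d+2}`
(`n^{d+1}` starting points × `n` bonds). -/
theorem cweight_zero (n : ℕ) (κ : Fin (d + 1)) : cweight n κ (0 : Fin (d + 1) → ℂ) = (n : ℂ) ^ (d + 2) := by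
  unfold cweight
  simp only [Pi.zero_apply, gsum_zero, Finset.prod_const, Finset.card_univ, Fintype.card_fin]
  ring

/-- [folklore] `‖gsum t n‖ ≤ n` for real `t`. -/
theorem norm_gsum_ofReal_le (t : ℝ) (n : ℕ) : ‖gsum (t : ℂ) n‖ ≤ n := by
  unfold gsum
  refine (norm_sum_le _ _).trans ?_
  have h : ∀ s ∈ Finset.range n, ‖cexp (I * (t : ℂ) * (s : ℂ))‖ = 1 := by
    intro s _
    rw [show I * (t : ℂ) * (s : ℂ) = ((t * s : ℝ) : ℂ) * I by push_cast; ring, Complex.norm_exp_ofReal_mul_I]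
  rw [Finset.sum_congr rfl h]
  simp

/-- [folklore] `‖cweight n κ k‖ ≤ n^{d+2}` at real momenta. -/
theorem norm_cweight_ofRealVec_le (n : ℕ) (κ : Fin (d + 1)) (q : Fin (d + 1) → ℝ) :
    ‖cweight n κ (ofRealVec q)‖ ≤ (n : ℝ) ^ (d + 2) := by
  unfold cweight
  rw [norm_mul, norm_prod, pow_succ]
  refine mul_le_mul ?_ (norm_gsum_ofReal_le (q κ) n) (norm_nonneg _) (by positivity)
  calc ∏ i, ‖gsum (ofRealVec q i) n‖ ≤ ∏ _i : Fin (d + 1), (n : ℝ) :=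
        Finset.prod_le_prod (fun i _ => norm_nonneg _) fun i _ => norm_gsum_ofReal_le (q i) n
    _ = (n : ℝ) ^ (d + 1) := by simp

/-- [our object] **NORMALISATION** (`Q ↦ c·Q` multiplies the coarse covariance by `c²` and its symbol by `c²`): under the hypotheses of `coarseCov_latticeKernel`,
`c² · coarseCov n K κ λ u v = latticeKernel (c² · covSym n κ λ G) (u − v)` — Bałaban's (1.11) `c = n^{−(d+1)}`, the coarse-unit mean `c = n^{−(d+2)}`. -/
theorem coarseCov_latticeKernel_scaled (n : ℕ) [NeZero n] (c : ℂ) {K : Fin (d + 1) → Fin (d + 1) → Site (d + 1) → ℂ}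
    {G : (Fin (d + 1) → ℂ) → ℂ} {κ l : Fin (d + 1)} (hK : ∀ x, K κ l x = latticeKernel G x)
    (hper : ∀ (i : Fin (d + 1)) (P : Fin (d + 1) → ℂ), G (Function.update P i (P i + 2 * π)) = G P)
    (hG : IntegrableOn (fun p => G (ofRealVec p)) (BZ (d + 1))) (u v : Site (d + 1)) :
    c ^ 2 * coarseCov n K κ l u v = latticeKernel (fun P => c ^ 2 * covSym n κ l G P) (u - v) := by
  rw [B4Green242Bridge.latticeKernel_const_mul, coarseCov_latticeKernel n hK hper hG]

/-! ## §5 The symbol of record: the MASS-ONE (coarse-unit mean) normalisation (owner ruling R-FP-21 (C), erratum E-FP-5-3) -/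

/-- [our object] **THE MASS-ONE COARSE COVARIANCE** `coarseCovMean n K := (n^{d+2})⁻² · coarseCov n K` — `Q_n^{mean} K (Q_n^{mean})ᵀ` for the mass-one straight-contour
average `Q_n^{mean} = n^{−(d+2)}·contourSum n` (each coarse bond reads `n^{d+2}` fine bonds; `cweight n κ 0 = n^{d+2}`). -/
def coarseCovMean (n : ℕ) (K : Fin (d + 1) → Fin (d + 1) → Site (d + 1) → ℂ) (κ l : Fin (d + 1)) (u v : Site (d + 1)) : ℂ :=
  (((n : ℂ) ^ (d + 2))⁻¹) ^ 2 * coarseCov n K κ l u v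

/-- [our object] **THE COARSE COVARIANCE SYMBOL OF RECORD** `Ĉ_n^{mean} := (n^{d+2})⁻² · covSym n` — i.e. `Ĉ_n^{mean}(k) = n^{−(3(d+1)+2)} Σ_l q̂(k,l)·Ĝ(k_l)·q̂(k,l)†`
with the UNNORMALISED contour weights `q̂` (`covSymMean_apply`); at `d+1 = 4` its `l = 0` term near `k = 0` is `≈ n^{−2}|k|^{−2}(…)` (H2IR-DESIGN §IR-2 (ii)). -/
def covSymMean (n : ℕ) (κ l : Fin (d + 1)) (G : (Fin (d + 1) → ℂ) → ℂ) : (Fin (d + 1) → ℂ) → ℂ :=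
  fun P => (((n : ℂ) ^ (d + 2))⁻¹) ^ 2 * covSym n κ l G P

/-- [our object] The explicit prefactor: `covSymMean n κ λ G P = (n^{3(d+1)+2})⁻¹ · Σ_l cweight n κ (k_l)·cweight n λ (−k_l)·G(k_l)`. -/
theorem covSymMean_apply (n : ℕ) [NeZero n] (κ l : Fin (d + 1)) (G : (Fin (d + 1) → ℂ) → ℂ) (P : Fin (d + 1) → ℂ) :
    covSymMean n κ l G P = ((n : ℂ) ^ (3 * (d + 1) + 2))⁻¹ *
      ∑ a : Fin (d + 1) → Fin n, cweight n κ (aliasPt n a P) * cweight n l (-(aliasPt n a P)) * G (aliasPt n a P) := by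
  unfold covSymMean covSym
  rw [← mul_assoc]
  congr 1
  have hn : (n : ℂ) ≠ 0 := by exact_mod_cast NeZero.ne n
  field_simp
  ring

/-- [our object] **THE MASS-ONE COARSE COVARIANCE IS THE COARSE LATTICE KERNEL OF THE SYMBOL OF RECORD**: under the hypotheses of `coarseCov_latticeKernel`,
`coarseCovMean n K κ λ u v = latticeKernel (covSymMean n κ λ G) (u − v)`. -/
theorem coarseCovMean_latticeKernel (n : ℕ) [NeZero n] {K : Fin (d + 1) → Fin (d + 1) → Site (d + 1) → ℂ}
    {G : (Fin (d + 1) → ℂ) → ℂ} {κ l : Fin (d + 1)} (hK : ∀ x, K κ l x = latticeKernel G x)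
    (hper : ∀ (i : Fin (d + 1)) (P : Fin (d + 1) → ℂ), G (Function.update P i (P i + 2 * π)) = G P)
    (hG : IntegrableOn (fun p => G (ofRealVec p)) (BZ (d + 1))) (u v : Site (d + 1)) :
    coarseCovMean n K κ l u v = latticeKernel (covSymMean n κ l G) (u - v) :=
  coarseCov_latticeKernel_scaled n _ hK hper hG u v

/-- [folklore] The symbol of record is globally `2π`-periodic in each coarse coordinate when `G` is. -/
theorem covSymMean_periodic (n : ℕ) [NeZero n] (κ l : Fin (d + 1)) {G : (Fin (d + 1) → ℂ) → ℂ}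
    (hper : ∀ (i : Fin (d + 1)) (P : Fin (d + 1) → ℂ), G (Function.update P i (P i + 2 * π)) = G P)
    (i : Fin (d + 1)) (P : Fin (d + 1) → ℂ) :
    covSymMean n κ l G (Function.update P i (P i + 2 * π)) = covSymMean n κ l G P := by
  unfold covSymMean
  rw [covSym_periodic n κ l hper i P]

end Summit.QuantumFields.BalabanUV.Beta.FP.CoarseCovarianceAlias

end
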